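import Summits.QuantumFields.YangMills.Theorems.BalabanUVNodesN19AdditiveLinksDegreeBudgetLogSq
import Summits.QuantumFields.YangMills.Theorems.BalabanUVNodesN19SingleModeLowerBound
import Summits.QuantumFields.YangMills.Theorems.BalabanUVNodesN19OscillatingLinksMomentDiscrepancy
import Summits.QuantumFields.YangMills.Theorems.BalabanUVNodesN19KinkLowerBoundLawsCube

/-!
# YM-DAG node N19 (= NE7 proper) — THE GENERAL LIPSCHITZ ROW, TWO-SIDED UP TO `log²`, AND ITS LAW-LEVEL (`W₁`) FACES
# (`d∕(π(9t+6)) ≤ sup_{h 1-Lip} dist_∞(h∘S_d, Π_t) ≤ 2·10⁵·d·log₂²t∕t`; laws agreeing on `Π_t`: `≤ 4·10⁵·K·d·log₂²t∕t`, also for `Σ_iφ_i(x_i)`)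

Cell `pub-ymgap`, HUMAN RULING D-0062 (Track A) ∕ D-0149 (work-bound push), R141 (C) wider-strategy seat `pub-ymgap-dag-n19-e` (strategy
s3 = ALTERNATIVE CURRENCY), generation g33, module 25 (lineage module 172).  Route `Summits/QuantumFields/YangMills/Theses/BalabanUVNodes.lean`,
cluster item K3⁸ «SpineGivenEndpointR13SepCoPHV» (stmt-QuantumFields-27366); filed `--supports` that item `--as helper` (it proves no registered
stub).  COUNT-NEUTRAL: [folklore] over the lineage BY NAME — module 168 `…N19LipschitzLinksDegreeBudgetLogSq`
(`exists_mvPolynomial_near_lipschitzLink_l1Norm_logSq`), module 171 `…N19AdditiveLinksDegreeBudgetLogSq` (`exists_mvPolynomial_near_lipschitzLink_additive_logSq`),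
module 134 (`exists_le_abs_l1Norm_sub_eval`), module 125 (`abs_integral_sub_integral_le_of_near`, `continuous_l1Norm`), module 137
(`exists_laws_equalMixedMoments_l1Norm`); TOY laws under HYPOTHESES; no scheme object, no Theses import; NOT a discharge claim.

CONTENT — module 153 ∕ module 169 with one logarithm fewer (modules 165–168, 171: the Jackson kernel).  §1 ★★★ `lipschitzLinks_twoSided_logSq`:
for `t ≥ 2`, (UPPER) every `K`-Lipschitz `h` on `[0, d]` has `P` of total degree `≤ t` with `|h(Σ_i|x_i|) − P(x)| ≤ 2·10⁵·K·d·log₂²t∕t` on the cube,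
(LOWER) every `P` of total degree `≤ t` misses `Σ_i|x_i|` by `≥ d∕(π(9t+6))` somewhere.  §2 ★★ `abs_integral_lipschitzLink_l1Norm_sub_le_of_moments_logSq`
(laws agreeing on `Π_t`: `≤ 2·(2·10⁵·K·d·log₂²t∕t)`), ★★★ `laws_lipschitzLinks_twoSided_logSq` (with module 137's `2d∕(π(9t+6))`), ★★
`abs_integral_lipschitzLink_additive_sub_le_of_moments_logSq` (the same for `h(Σ_iφ_i(x_i))`, `φ_i : [−1,1] → [0,1]` continuous `1`-Lipschitz).
READING (CURRENCY-MAP (v′), OPEN-PROBLEM.md forms 1–2): the general Lipschitz row is `Θ(d∕t)` up to `log²t` in both the degree model and the `W₁`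
form.

HONEST FRAMING (binding).  Elementary and [folklore]; TOY laws under hypotheses; NO consumer in the DAG today (the seat's own currency map); nothing
of Bałaban's instantiated; NE7 NOT PRINTED, NOT proved; N19 NOT discharged; count-neutral.  One finite `T⁴` programme at fixed `ε`; nothing
continuum ∕ `ℝ⁴` ∕ OS ∕ mass-gap ∕ Clay.  0 `def` ∕ 0 `sorry`.
-/

noncomputable section

open Finset MeasureTheory
open scoped Real

namespace Summit.QuantumFields.YangMills.Theorems.BalabanUVNodesN19LipschitzLinksTwoSidedLogSq

open Summit.QuantumFields.YangMills.Theorems.BalabanUVNodesN19LipschitzLinksDegreeBudgetLogSq (exists_mvPolynomial_near_lipschitzLink_l1Norm_logSq)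
open Summit.QuantumFields.YangMills.Theorems.BalabanUVNodesN19AdditiveLinksDegreeBudgetLogSq (exists_mvPolynomial_near_lipschitzLink_additive_logSq)
open Summit.QuantumFields.YangMills.Theorems.BalabanUVNodesN19SingleModeLowerBound (exists_le_abs_l1Norm_sub_eval)
open Summit.QuantumFields.YangMills.Theorems.BalabanUVNodesN19OscillatingLinksMomentDiscrepancy
  (abs_integral_sub_integral_le_of_near continuous_l1Norm)
open Summit.QuantumFields.YangMills.Theorems.BalabanUVNodesN19KinkLowerBoundLawsCube (exists_laws_equalMixedMoments_l1Norm)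

variable {ι : Type*} [Fintype ι] [Nonempty ι]

/-! ## §1 ★★★ The general Lipschitz row, two-sided up to `log²` [folklore] -/

/-- ★★★ **THE GENERAL LIPSCHITZ ROW IS `Θ(d∕t)` UP TO `log²t` (both sides in one declaration).**  For finite nonempty `ι` (`d = |ι|`) and `t ≥ 2`:
(UPPER) for every `K ≥ 0` and every `h : ℝ → ℝ` with `|h(s) − h(s′)| ≤ K|s − s′|` on `[0, d]` there is `P : MvPolynomial ι ℝ` of total degree
`≤ t` with `|h(Σ_i|x_i|) − P(x)| ≤ 2·10⁵·K·d·(log₂t)²∕t` on `[−1,1]^ι` (module 168); (LOWER) for every `P` of total degree `≤ t` some `x` in the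
cube has `|Σ_i|x_i| − P(x)| ≥ d∕(π(9t+6))` (module 134). [folklore] -/
theorem lipschitzLinks_twoSided_logSq {t : ℕ} (ht : 2 ≤ t) :
    (∀ (K : ℝ) (h : ℝ → ℝ), 0 ≤ K →
      (∀ s s', s ∈ Set.Icc (0 : ℝ) (Fintype.card ι) → s' ∈ Set.Icc (0 : ℝ) (Fintype.card ι) → |h s - h s'| ≤ K * |s - s'|) →
      ∃ P : MvPolynomial ι ℝ, P.totalDegree ≤ t ∧
        ∀ x : ι → ℝ, (∀ i, x i ∈ Set.Icc (-1 : ℝ) 1) →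
          |h (∑ i, |x i|) - MvPolynomial.eval x P| ≤ 200000 * K * Fintype.card ι * Real.logb 2 t ^ 2 / t) ∧
    (∀ P : MvPolynomial ι ℝ, P.totalDegree ≤ t →
      ∃ x : ι → ℝ, (∀ i, x i ∈ Set.Icc (-1 : ℝ) 1) ∧
        Fintype.card ι / (π * (9 * t + 6)) ≤ |(∑ i, |x i|) - MvPolynomial.eval x P|) :=
  ⟨fun _ _ hK0 hK => exists_mvPolynomial_near_lipschitzLink_l1Norm_logSq hK0 hK ht,
    fun P hP => exists_le_abs_l1Norm_sub_eval (le_trans (by norm_num) ht) P hP⟩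

/-! ## §2 ★★★ The law-level (`W₁`) faces up to `log²` [folklore] -/

/-- ★★ **LAWS AGREEING ON `Π_t` INTEGRATE EVERY LIPSCHITZ LINK OF `Σ|x_i|` TO WITHIN `4·10⁵·K·d·log₂²t∕t`.**  Let `P, Q` be probability laws on
`ℝ^ι` carried by `[−1,1]^ι` with equal mixed moments of total degree `≤ t` (`t ≥ 2`), and `h : ℝ → ℝ` with `|h(s) − h(s′)| ≤ K|s − s′|` on `ℝ`,
`K ≥ 0`.  Then `|∫h(Σ_i|x_i|)dP − ∫h(Σ_i|x_i|)dQ| ≤ 2·(2·10⁵·K·d·(log₂t)²∕t)` (module 125's transfer with §1's polynomial). [folklore] -/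
theorem abs_integral_lipschitzLink_l1Norm_sub_le_of_moments_logSq {P Q : Measure (ι → ℝ)} [IsProbabilityMeasure P] [IsProbabilityMeasure Q]
    (hP : P (Set.pi Set.univ (fun _ : ι => Set.Icc (-1 : ℝ) 1))ᶜ = 0) (hQ : Q (Set.pi Set.univ (fun _ : ι => Set.Icc (-1 : ℝ) 1))ᶜ = 0)
    {t : ℕ} (ht : 2 ≤ t) (hmom : ∀ j : ι → ℕ, ∑ i, j i ≤ t → ∫ x, ∏ i, x i ^ j i ∂P = ∫ x, ∏ i, x i ^ j i ∂Q)
    {h : ℝ → ℝ} {K : ℝ} (hK0 : 0 ≤ K) (hK : ∀ s s', |h s - h s'| ≤ K * |s - s'|) :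
    |∫ x, h (∑ i, |x i|) ∂P - ∫ x, h (∑ i, |x i|) ∂Q| ≤ 2 * (200000 * K * Fintype.card ι * Real.logb 2 t ^ 2 / t) := by
  obtain ⟨F, hF, happ⟩ := exists_mvPolynomial_near_lipschitzLink_l1Norm_logSq (ι := ι) hK0 (fun s s' _ _ => hK s s') ht
  have hLip : LipschitzWith (Real.toNNReal K) h := by
    refine LipschitzWith.of_dist_le_mul fun x y => ?_
    rw [Real.dist_eq, Real.dist_eq, Real.coe_toNNReal _ hK0]
    exact hK x y
  have hg : Continuous fun x : ι → ℝ => h (∑ i, |x i|) := hLip.continuous.comp continuous_l1Norm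
  exact abs_integral_sub_integral_le_of_near hP hQ hmom hg hF happ

/-- ★★★ **THE LAW-LEVEL ROW IS `Θ(d∕t)` UP TO `log²t` (both sides in one declaration).**  For finite nonempty `ι` (`d = |ι|`) and `t ≥ 2`: (UPPER)
every two probability laws on `ℝ^ι` carried by `[−1,1]^ι` with equal mixed moments of total degree `≤ t` and every `K`-Lipschitz `h` on `ℝ`
(`K ≥ 0`) satisfy `|∫h(Σ|x_i|)dP − ∫h(Σ|x_i|)dQ| ≤ 4·10⁵·K·d·log₂²t∕t`; (LOWER, module 137) there IS such a pair with
`∫Σ|x_i| dQ − ∫Σ|x_i| dP ≥ 2d∕(π(9t+6))`. [folklore] -/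
theorem laws_lipschitzLinks_twoSided_logSq {t : ℕ} (ht : 2 ≤ t) :
    (∀ P Q : Measure (ι → ℝ), IsProbabilityMeasure P → IsProbabilityMeasure Q →
      P (Set.pi Set.univ (fun _ : ι => Set.Icc (-1 : ℝ) 1))ᶜ = 0 → Q (Set.pi Set.univ (fun _ : ι => Set.Icc (-1 : ℝ) 1))ᶜ = 0 →
      (∀ j : ι → ℕ, ∑ i, j i ≤ t → ∫ x, ∏ i, x i ^ j i ∂P = ∫ x, ∏ i, x i ^ j i ∂Q) →
      ∀ (K : ℝ) (h : ℝ → ℝ), 0 ≤ K → (∀ s s', |h s - h s'| ≤ K * |s - s'|) →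
        |∫ x, h (∑ i, |x i|) ∂P - ∫ x, h (∑ i, |x i|) ∂Q| ≤ 2 * (200000 * K * Fintype.card ι * Real.logb 2 t ^ 2 / t)) ∧
    (∃ P Q : Measure (ι → ℝ), IsProbabilityMeasure P ∧ IsProbabilityMeasure Q ∧
      P (Set.pi Set.univ (fun _ : ι => Set.Icc (-1 : ℝ) 1))ᶜ = 0 ∧ Q (Set.pi Set.univ (fun _ : ι => Set.Icc (-1 : ℝ) 1))ᶜ = 0 ∧
      (∀ j : ι → ℕ, ∑ i, j i ≤ t → ∫ x, ∏ i, x i ^ j i ∂P = ∫ x, ∏ i, x i ^ j i ∂Q) ∧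
      2 * Fintype.card ι / (π * (9 * t + 6)) ≤ (∫ x, ∑ i, |x i| ∂Q) - ∫ x, ∑ i, |x i| ∂P) := by
  refine ⟨fun P Q iP iQ hP hQ hmom K h hK0 hK => ?_, exists_laws_equalMixedMoments_l1Norm (le_trans (by norm_num) ht)⟩
  exact abs_integral_lipschitzLink_l1Norm_sub_le_of_moments_logSq hP hQ ht hmom hK0 hK

/-- ★★ **LAWS AGREEING ON `Π_t` INTEGRATE EVERY LIPSCHITZ LINK OF `Σ_iφ_i(x_i)` TO WITHIN `4·10⁵·K·d·log₂²t∕t`.**  Let `φ_i : ℝ → ℝ` be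
continuous, `1`-Lipschitz with values in `[0,1]` on `[−1,1]`; `P, Q` probability laws on `ℝ^ι` carried by `[−1,1]^ι` with equal mixed moments of
total degree `≤ t` (`t ≥ 2`); `h : ℝ → ℝ` with `|h(s) − h(s′)| ≤ K|s − s′|` on `ℝ` (`K ≥ 0`).  Then
`|∫h(Σ_iφ_i(x_i))dP − ∫h(Σ_iφ_i(x_i))dQ| ≤ 2·(2·10⁵·K·d·(log₂t)²∕t)` (module 169 with one logarithm fewer). [folklore] -/
theorem abs_integral_lipschitzLink_additive_sub_le_of_moments_logSq {φ : ι → ℝ → ℝ}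
    (hφL : ∀ i, ∀ u v : ℝ, u ∈ Set.Icc (-1 : ℝ) 1 → v ∈ Set.Icc (-1 : ℝ) 1 → |φ i u - φ i v| ≤ 1 * |u - v|)
    (hφ0 : ∀ i, ∀ u : ℝ, u ∈ Set.Icc (-1 : ℝ) 1 → 0 ≤ φ i u) (hφ1 : ∀ i, ∀ u : ℝ, u ∈ Set.Icc (-1 : ℝ) 1 → φ i u ≤ 1)
    (hφc : ∀ i, Continuous (φ i)) {P Q : Measure (ι → ℝ)} [IsProbabilityMeasure P] [IsProbabilityMeasure Q]
    (hP : P (Set.pi Set.univ (fun _ : ι => Set.Icc (-1 : ℝ) 1))ᶜ = 0) (hQ : Q (Set.pi Set.univ (fun _ : ι => Set.Icc (-1 : ℝ) 1))ᶜ = 0)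
    {t : ℕ} (ht : 2 ≤ t) (hmom : ∀ j : ι → ℕ, ∑ i, j i ≤ t → ∫ x, ∏ i, x i ^ j i ∂P = ∫ x, ∏ i, x i ^ j i ∂Q)
    {h : ℝ → ℝ} {K : ℝ} (hK0 : 0 ≤ K) (hK : ∀ s s', |h s - h s'| ≤ K * |s - s'|) :
    |∫ x, h (∑ i, φ i (x i)) ∂P - ∫ x, h (∑ i, φ i (x i)) ∂Q| ≤ 2 * (200000 * K * Fintype.card ι * Real.logb 2 t ^ 2 / t) := by
  obtain ⟨F, hF, happ⟩ := exists_mvPolynomial_near_lipschitzLink_additive_logSq hφL hφ0 hφ1 hK0 (fun s s' _ _ => hK s s') ht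
  have hLip : LipschitzWith (Real.toNNReal K) h := by
    refine LipschitzWith.of_dist_le_mul fun x y => ?_
    rw [Real.dist_eq, Real.dist_eq, Real.coe_toNNReal _ hK0]
    exact hK x y
  have hTc : Continuous fun x : ι → ℝ => ∑ i, φ i (x i) := continuous_finsetSum _ fun i _ => (hφc i).comp (continuous_apply i)
  have hg : Continuous fun x : ι → ℝ => h (∑ i, φ i (x i)) := hLip.continuous.comp hTc
  exact abs_integral_sub_integral_le_of_near hP hQ hmom hg hF happ

end Summit.QuantumFields.YangMills.Theorems.BalabanUVNodesN19LipschitzLinksTwoSidedLogSq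

end
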